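import Mathlib
import HarnessLib
import Summits.QuantumAdvantage.Statement
import Summits.QuantumAdvantage.AdviceFreeQNC0.AdviceFreeQNC0
import Summits.QuantumAdvantage.AdviceFreeQNC0.RingHardOdd
import Summits.QuantumAdvantage.AdviceFreeQNC0.AdviceFreeQNC0Three
import Summits.QuantumAdvantage.AdviceFreeQNC0.RingKernel
import Summits.QuantumAdvantage.AdviceFreeQNC0.RingRotation
import Summits.QuantumAdvantage.QuantumAdvantage.Theses.SpreadDial
import Literature.Computability.QuantumComplexity.ShallowCircuitsRingSolutions
import Literature.Computability.MetaComplexity.SmolenskyCorrelationRestrict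

/-!
# SteerDial (1/7): SteerDialFold

§F — the identity-word FOLD LAW: padding a ring input by an identity word `w` (`T_w = 1`) with its kernel transport
(`liftVec`, block statistics `blockEdges`/`blockAnd`, certificates `wordCert`), and the loss transport
`card_loss_wfold_le`: a strategy for the longer ring, folded, loses at least as often as the original.

Part 1 of 7 of the prover-side twin of the workshop node «SteerDial» (route `SpreadDial`, node on 29065 `CoverLift3`;
lineage decomp-qadv-lens-5, generation 7).  Content verbatim from the monolithic twin `tree/SpreadDialSteer.lean`
(sha256 5f501baf…, farm rc0 · 0 err · 0 warn · 0 sorry; axioms `propext`/`Classical.choice`/`Quot.sound` for every theorem),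
cut at section boundaries to meet the 400-line rule.  No `def … : Prop`, no `instance`, no `notation`.
-/

set_option linter.style.longLine false
set_option linter.dupNamespace false

namespace Summit.QuantumAdvantage.QuantumAdvantage.Theorems.SteerDial

open Finset
open Literature.Computability.QuantumComplexity Literature.Computability.MetaComplexity
open Literature.Computability.QuantumComplexity.RingHLF
open Summit.QuantumAdvantage.AdviceFreeQNC0
open Summit.QuantumAdvantage.QuantumAdvantage.Theses

/-! ## §F  The identity-word fold (kernel transport by transfer-matrix trajectories) -/

section Fold
variable {n m : ℕ}

/-- Pad a pattern `y` of `C_n` with the word `w` at the new positions `n, …, n+m-1` (between `n-1` and `0`). -/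
def pad (w : Fin m → Bool) (y : Fin n → Bool) : Fin (n + m) → Bool := Fin.append y w

/-- `w` is an IDENTITY WORD: its transfer monodromy fixes every state (`T_w = 1` in `GL₂(𝔽₂) ≅ S₃`); Boolean test. -/
def idWord (w : Fin m → Bool) : Bool := decide (∀ s : St, monodromy (List.ofFn w) s = s)

/-- SteerDial helper `idWord_spec` (lens-5 g7 SteerDial twin; see the enclosing section docstring). -/
theorem idWord_spec {w : Fin m → Bool} (hw : idWord w = true) (s : St) : monodromy (List.ofFn w) s = s :=
  (of_decide_eq_true (p := ∀ s : St, monodromy (List.ofFn w) s = s) hw) s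

/-- SteerDial helper `ofFn_pad` (lens-5 g7 SteerDial twin; see the enclosing section docstring). -/
theorem ofFn_pad (w : Fin m → Bool) (y : Fin n → Bool) :
    List.ofFn (pad w y) = List.ofFn y ++ List.ofFn w := List.ofFn_fin_append _ _

/-- SteerDial helper `pad_castAdd` (lens-5 g7 SteerDial twin; see the enclosing section docstring). -/
@[simp] theorem pad_castAdd (w : Fin m → Bool) (y : Fin n → Bool) (i : Fin n) :
    pad w y (Fin.castAdd m i) = y i := Fin.append_left _ _ _

/-- SteerDial helper `pad_natAdd` (lens-5 g7 SteerDial twin; see the enclosing section docstring). -/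
@[simp] theorem pad_natAdd (w : Fin m → Bool) (y : Fin n → Bool) (j : Fin m) :
    pad w y (Fin.natAdd n j) = w j := Fin.append_right _ _ _

/-- SteerDial helper `iter_pad_of_le` (lens-5 g7 SteerDial twin; see the enclosing section docstring). -/
theorem iter_pad_of_le (w : Fin m → Bool) (y : Fin n → Bool) {k : ℕ} (hk : k ≤ n) (s : St) :
    iter (pad w y) k s = iter y k s := by
  unfold iter
  rw [ofFn_pad, List.take_append_of_le_length (by simpa using hk)]

/-- SteerDial helper `iter_pad_add` (lens-5 g7 SteerDial twin; see the enclosing section docstring). -/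
theorem iter_pad_add (w : Fin m → Bool) (y : Fin n → Bool) (k : ℕ) (s : St) :
    iter (pad w y) (n + k) s = iter w k (iter y n s) := by
  unfold iter
  rw [ofFn_pad, List.take_append, List.take_of_length_le (l := List.ofFn y) (i := n + k) (by simp),
    List.foldl_append, List.take_of_length_le (l := List.ofFn y) (i := n) (by simp)]
  simp

/-- SteerDial helper `monodromy_pad` (lens-5 g7 SteerDial twin; see the enclosing section docstring). -/
theorem monodromy_pad (w : Fin m → Bool) (y : Fin n → Bool) (s : St) :
    monodromy (List.ofFn (pad w y)) s = monodromy (List.ofFn w) (monodromy (List.ofFn y) s) := by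
  rw [ofFn_pad]; unfold monodromy; rw [List.foldl_append]

/-- The lifted vector: `v` on the old positions, the block trajectory `kernelVec w s` on the new ones. -/
def liftVec (w : Fin m → Bool) (v : Fin n → Bool) (s : St) : Fin (n + m) → Bool :=
  Fin.append v (kernelVec w s)

/-- SteerDial helper `liftVec_castAdd` (lens-5 g7 SteerDial twin; see the enclosing section docstring). -/
@[simp] theorem liftVec_castAdd (w : Fin m → Bool) (v : Fin n → Bool) (s : St) (i : Fin n) :
    liftVec w v s (Fin.castAdd m i) = v i := Fin.append_left _ _ _

/-- SteerDial helper `liftVec_natAdd` (lens-5 g7 SteerDial twin; see the enclosing section docstring). -/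
@[simp] theorem liftVec_natAdd (w : Fin m → Bool) (v : Fin n → Bool) (s : St) (j : Fin m) :
    liftVec w v s (Fin.natAdd n j) = kernelVec w s j := Fin.append_right _ _ _

/-- The initial state `(v_{n-1}, v_0)` of a vector on `C_n`. -/
def st0 (hn : 3 ≤ n) (v : Fin n → Bool) : St := (v ⟨n - 1, by omega⟩, v ⟨0, by omega⟩)

/-- For `v ∈ K(y)` and an identity word, the lift IS the trajectory of `(v_{n-1}, v_0)` on the padded ring. -/
theorem liftVec_eq_kernelVec (hn : 3 ≤ n) (w : Fin m → Bool) {y v : Fin n → Bool} (hv : InKernel y v) :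
    liftVec w v (st0 hn v) = kernelVec (pad w y) (st0 hn v) := by
  unfold st0
  have hfix := monodromy_fixed_of_inKernel hn hv
  funext b
  refine Fin.addCases (fun i => ?_) (fun j => ?_) b
  · rw [liftVec_castAdd]
    unfold kernelVec
    rw [show (Fin.castAdd m i).val = i.val from rfl, iter_pad_of_le w y i.isLt.le,
      iter_eq_of_inKernel hn hv i.val i.isLt.le]
    simp only
    congr 1
    exact Fin.ext (by simp [Nat.mod_eq_of_lt i.isLt])
  · rw [liftVec_natAdd]
    unfold kernelVec
    rw [show (Fin.natAdd n j).val = n + j.val from rfl, iter_pad_add, iter_length, hfix]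

/-- **Kernel transport.** For an identity word `w` and `v ∈ K(y)`, the lift lies in `K(pad w y)`. -/
theorem inKernel_liftVec (hn : 3 ≤ n) {w : Fin m → Bool} (hw : idWord w = true) {y v : Fin n → Bool}
    (hv : InKernel y v) : InKernel (pad w y) (liftVec w v (st0 hn v)) := by
  rw [liftVec_eq_kernelVec hn w hv]
  refine inKernel_kernelVec (by omega) (pad w y) ?_
  unfold st0
  rw [monodromy_pad, monodromy_fixed_of_inKernel hn hv, idWord_spec hw]

/-! ### Splitting counts over `Fin (n+m)` into the old ring and the block -/

/-- SteerDial helper `card_filter_add` (lens-5 g7 SteerDial twin; see the enclosing section docstring). -/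
theorem card_filter_add (p : Fin (n + m) → Prop) [DecidablePred p] :
    (univ.filter p).card = (univ.filter fun i : Fin n => p (Fin.castAdd m i)).card +
      (univ.filter fun j : Fin m => p (Fin.natAdd n j)).card := by
  simp only [card_filter]
  exact Fin.sum_univ_add _

/-- SteerDial helper `nxt_val` (lens-5 g7 SteerDial twin; see the enclosing section docstring). -/
theorem nxt_val {N : ℕ} (b : Fin N) : (nxt b).val = if b.val + 1 = N then 0 else b.val + 1 := by
  have hb := b.isLt
  show (b.val + 1) % N = _
  split_ifs with h
  · rw [h, Nat.mod_self]
  · exact Nat.mod_eq_of_lt (by omega)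

/-- SteerDial helper `append_of_lt` (lens-5 g7 SteerDial twin; see the enclosing section docstring). -/
theorem append_of_lt {α : Type*} (u : Fin n → α) (u' : Fin m → α) (b : Fin (n + m)) (h : b.val < n) :
    Fin.append u u' b = u ⟨b.val, h⟩ := by
  have e : b = Fin.castAdd m ⟨b.val, h⟩ := Fin.ext rfl
  conv_lhs => rw [e]
  exact Fin.append_left _ _ _

/-- SteerDial helper `append_of_le` (lens-5 g7 SteerDial twin; see the enclosing section docstring). -/
theorem append_of_le {α : Type*} (u : Fin n → α) (u' : Fin m → α) (b : Fin (n + m)) (h : n ≤ b.val) :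
    Fin.append u u' b = u' ⟨b.val - n, by omega⟩ := by
  have e : b = Fin.natAdd n ⟨b.val - n, by omega⟩ := Fin.ext (by simp; omega)
  conv_lhs => rw [e]
  exact Fin.append_right _ _ _

/-- SteerDial helper `kernelVec_zero'` (lens-5 g7 SteerDial twin; see the enclosing section docstring). -/
@[simp] theorem kernelVec_zero' (w : Fin m → Bool) (s : St) (h : 0 < m) : kernelVec w s ⟨0, h⟩ = s.2 := by
  simp [kernelVec]

/-- The block successor value: the next block entry, or `s.2 = v_0` after the last block position. -/
def bnext (w : Fin m → Bool) (s : St) (j : Fin m) : Bool :=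
  if h : j.val + 1 < m then kernelVec w s ⟨j.val + 1, h⟩ else s.2

/-- Edges inside the support of the lifted vector that involve a block position (as left endpoint the position
`n-1` contributes `[v_{n-1} ∧ v_0]` exactly as in the old ring, so only block left-endpoints are new). -/
def blockEdges (w : Fin m → Bool) (s : St) : ℕ :=
  (univ.filter fun j : Fin m => kernelVec w s j = true ∧ bnext w s j = true).card

/-- `|w ∧ u|` on the block. -/
def blockAnd (w : Fin m → Bool) (s : St) : ℕ :=
  (univ.filter fun j : Fin m => w j = true ∧ kernelVec w s j = true).card

/-- SteerDial helper `liftVec_nxt_castAdd` (lens-5 g7 SteerDial twin; see the enclosing section docstring). -/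
theorem liftVec_nxt_castAdd (hn : 3 ≤ n) (hm : 1 ≤ m) (w : Fin m → Bool) (v : Fin n → Bool) (s : St)
    (hs : s.2 = v ⟨0, by omega⟩) (i : Fin n) :
    liftVec w v s (nxt (Fin.castAdd m i)) = v (nxt i) := by
  have hi := i.isLt
  have hval : (nxt (Fin.castAdd m i)).val = if i.val + 1 = n + m then 0 else i.val + 1 := nxt_val _
  by_cases h : i.val + 1 < n
  · rw [if_neg (by omega)] at hval
    unfold liftVec
    rw [append_of_lt v _ _ (by omega)]
    congr 1
    exact Fin.ext (by rw [hval, nxt_val, if_neg (by omega)])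
  · have he : i.val + 1 = n := by omega
    rw [if_neg (by omega)] at hval
    unfold liftVec
    rw [append_of_le v _ _ (by omega)]
    have h0 : (⟨(nxt (Fin.castAdd m i)).val - n, by omega⟩ : Fin m) = ⟨0, by omega⟩ := Fin.ext (by simp [hval, he])
    rw [h0, kernelVec_zero', hs]
    congr 1
    exact Fin.ext (by rw [nxt_val, if_pos he])

/-- SteerDial helper `liftVec_nxt_natAdd` (lens-5 g7 SteerDial twin; see the enclosing section docstring). -/
theorem liftVec_nxt_natAdd (hn : 3 ≤ n) (w : Fin m → Bool) (v : Fin n → Bool) (s : St)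
    (hs : s.2 = v ⟨0, by omega⟩) (j : Fin m) :
    liftVec w v s (nxt (Fin.natAdd n j)) = bnext w s j := by
  have hj := j.isLt
  have hval : (nxt (Fin.natAdd n j)).val = if n + j.val + 1 = n + m then 0 else n + j.val + 1 := nxt_val _
  unfold bnext liftVec
  by_cases h : j.val + 1 < m
  · rw [if_neg (by omega)] at hval
    rw [dif_pos h, append_of_le v _ _ (by omega)]
    congr 1
    exact Fin.ext (by simp [hval]; omega)
  · rw [if_pos (by omega)] at hval
    rw [dif_neg h, append_of_lt v _ _ (by omega), hs]
    congr 1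
    exact Fin.ext hval

/-- Edge count of the lift = edge count of `v` + the block edges. -/
theorem edgesIn_liftVec (hn : 3 ≤ n) (hm : 1 ≤ m) (w : Fin m → Bool) (v : Fin n → Bool) (s : St)
    (hs : s.2 = v ⟨0, by omega⟩) :
    edgesIn (liftVec w v s) = edgesIn v + blockEdges w s := by
  unfold edgesIn blockEdges
  rw [card_filter_add]
  congr 1
  · exact congrArg Finset.card (filter_congr fun i _ => by rw [liftVec_castAdd, liftVec_nxt_castAdd hn hm w v s hs])
  · exact congrArg Finset.card (filter_congr fun j _ => by rw [liftVec_natAdd, liftVec_nxt_natAdd hn w v s hs])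

/-- Overlap of the lift with the padded pattern = old overlap + block overlap. -/
theorem wtAnd_liftVec (w : Fin m → Bool) (y v : Fin n → Bool) (s : St) :
    wtAnd (pad w y) (liftVec w v s) = wtAnd y v + blockAnd w s := by
  unfold wtAnd blockAnd
  rw [card_filter_add]
  simp only [pad_castAdd, liftVec_castAdd, pad_natAdd, liftVec_natAdd]

/-- The parity `⟨lift v, Z⟩` splits into the old part and the block part. -/
theorem dot2_liftVec (w : Fin m → Bool) (v : Fin n → Bool) (s : St) (Z : Fin (n + m) → Bool) :
    dot2 (liftVec w v s) Z = ((univ.filter fun i : Fin n => v i = true ∧ Z (Fin.castAdd m i) = true).card +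
      (univ.filter fun j : Fin m => kernelVec w s j = true ∧ Z (Fin.natAdd n j) = true).card) % 2 := by
  unfold dot2
  rw [card_filter_add]
  simp only [liftVec_castAdd, liftVec_natAdd]

/-- Sign bit of the lift: old sign bit data + block data. -/
theorem signBit_liftVec (hn : 3 ≤ n) (hm : 1 ≤ m) (w : Fin m → Bool) (y v : Fin n → Bool) (s : St)
    (hs : s.2 = v ⟨0, by omega⟩) :
    signBit (pad w y) (liftVec w v s) = (edgesIn v + blockEdges w s + (wtAnd y v + blockAnd w s) / 2) % 2 := by
  unfold signBit
  rw [edgesIn_liftVec hn hm w v s hs, wtAnd_liftVec]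

/-! ### Parity bookkeeping -/

/-- SteerDial helper `card_filter_xor_mod_two` (lens-5 g7 SteerDial twin; see the enclosing section docstring). -/
theorem card_filter_xor_mod_two (f g Zb : Fin m → Bool) :
    (univ.filter fun j => (xor (f j) (g j)) = true ∧ Zb j = true).card % 2 =
      ((univ.filter fun j => f j = true ∧ Zb j = true).card + (univ.filter fun j => g j = true ∧ Zb j = true).card) % 2 := by
  rw [card_filter, card_filter, card_filter, ← sum_add_distrib]
  have h1 : (∑ j : Fin m, (if (xor (f j) (g j)) = true ∧ Zb j = true then 1 else 0 : ℕ)) % 2 =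
      (∑ j : Fin m, (if (xor (f j) (g j)) = true ∧ Zb j = true then 1 else 0 : ℕ) % 2) % 2 :=
    Finset.sum_nat_mod _ _ _
  have h2 : (∑ j : Fin m, ((if f j = true ∧ Zb j = true then 1 else 0 : ℕ) + (if g j = true ∧ Zb j = true then 1 else 0 : ℕ))) % 2 =
      (∑ j : Fin m, ((if f j = true ∧ Zb j = true then 1 else 0 : ℕ) + (if g j = true ∧ Zb j = true then 1 else 0 : ℕ)) % 2) % 2 :=
    Finset.sum_nat_mod _ _ _
  rw [h1, h2]
  congr 1
  refine sum_congr rfl fun j _ => ?_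
  cases f j <;> cases g j <;> cases Zb j <;> simp

/-- The block part of `⟨lift v, Z⟩` for a block trajectory LINEAR in the initial state. -/
theorem card_block_mod_two (α β u Zb : Fin m → Bool) (s : St)
    (hu : ∀ j, u j = ((α j && s.1) ^^ (β j && s.2))) :
    (univ.filter fun j => u j = true ∧ Zb j = true).card % 2 =
      ((if s.1 = true then (univ.filter fun j => α j = true ∧ Zb j = true).card else 0) +
       (if s.2 = true then (univ.filter fun j => β j = true ∧ Zb j = true).card else 0)) % 2 := by
  obtain ⟨p, q⟩ := s
  have hu' : u = fun j => ((α j && p) ^^ (β j && q)) := funext hu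
  subst hu'
  cases p <;> cases q
  · simp
  · simp
  · simp
  · simp only [Bool.and_true, if_true]
    exact card_filter_xor_mod_two α β Zb

/-- SteerDial helper `ite_xor_split` (lens-5 g7 SteerDial twin; see the enclosing section docstring). -/
theorem ite_xor_split : ∀ u x c : Bool,
    (if u = true ∧ xor x c = true then 1 else 0 : ℕ) + 2 * (if u = true ∧ x = true ∧ c = true then 1 else 0) =
      (if u = true ∧ x = true then 1 else 0) + (if u = true ∧ c = true then 1 else 0) := by
  decide

/-- The parity of `Z` on the block positions selected by `γ`. -/
def parityOn (n : ℕ) (γ : Fin m → Bool) (Z : Fin (n + m) → Bool) : Bool :=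
  decide ((univ.filter fun j : Fin m => γ j = true ∧ Z (Fin.natAdd n j) = true).card % 2 = 1)

/-- **The folded output**: the block's output bits are XOR-ed into positions `n-1` (those whose kernel entry carries
`v_{n-1}`) and `0` (those carrying `v_0`), together with the constant sign flips `a`, `b` of the word. -/
def foldOut (n : ℕ) (α β : Fin m → Bool) (a b : Bool) (Z : Fin (n + m) → Bool) : Fin n → Bool := fun i =>
  xor (Z (Fin.castAdd m i))
    (if i.val = n - 1 then xor (parityOn n α Z) a else if i.val = 0 then xor (parityOn n β Z) b else false)

/-- SteerDial helper `dot2_foldOut` (lens-5 g7 SteerDial twin; see the enclosing section docstring). -/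
theorem dot2_foldOut (hn : 3 ≤ n) (v : Fin n → Bool) (α β : Fin m → Bool) (a b : Bool) (Z : Fin (n + m) → Bool) :
    dot2 v (foldOut n α β a b Z) =
      ((univ.filter fun i : Fin n => v i = true ∧ Z (Fin.castAdd m i) = true).card +
        (if v ⟨n - 1, by omega⟩ = true ∧ xor (parityOn n α Z) a = true then 1 else 0) +
        (if v ⟨0, by omega⟩ = true ∧ xor (parityOn n β Z) b = true then 1 else 0)) % 2 := by
  unfold dot2
  rw [card_filter, card_filter]
  set i0 : Fin n := ⟨0, by omega⟩ with hi0
  set il : Fin n := ⟨n - 1, by omega⟩ with hil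
  have hne : i0 ≠ il := by
    intro h; have := congrArg Fin.val h; simp [hi0, hil] at this; omega
  have hmeml : il ∈ (univ : Finset (Fin n)) := mem_univ _
  have hmem0 : i0 ∈ (univ : Finset (Fin n)).erase il := mem_erase.2 ⟨hne, mem_univ _⟩
  rw [← add_sum_erase _ _ hmeml, ← add_sum_erase _ _ hmem0]
  rw [← add_sum_erase _ _ hmeml, ← add_sum_erase _ _ hmem0]
  have hrest : ∑ i ∈ ((univ : Finset (Fin n)).erase il).erase i0, (if v i = true ∧ foldOut n α β a b Z i = true then 1 else 0) =
      ∑ i ∈ ((univ : Finset (Fin n)).erase il).erase i0, (if v i = true ∧ Z (Fin.castAdd m i) = true then 1 else 0) := by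
    refine sum_congr rfl fun i hi => ?_
    have h1 : i ≠ i0 := (mem_erase.1 hi).1
    have h2 : i ≠ il := (mem_erase.1 (mem_erase.1 hi).2).1
    have h1' : i.val ≠ 0 := fun h => h1 (Fin.ext (by rw [h, hi0]))
    have h2' : i.val ≠ n - 1 := fun h => h2 (Fin.ext (by rw [h, hil]))
    simp only [foldOut, if_neg h2', if_neg h1', Bool.xor_false]
  have hzl : foldOut n α β a b Z il = xor (Z (Fin.castAdd m il)) (xor (parityOn n α Z) a) := by
    simp only [foldOut, hil, if_true]
  have hz0 : foldOut n α β a b Z i0 = xor (Z (Fin.castAdd m i0)) (xor (parityOn n β Z) b) := by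
    show xor (Z (Fin.castAdd m i0)) (if i0.val = n - 1 then _ else if i0.val = 0 then _ else false) = _
    rw [if_neg (show i0.val ≠ n - 1 by rw [hi0]; simp; omega), if_pos (show i0.val = 0 by rw [hi0])]
  rw [hrest, hz0, hzl]
  have e0 := ite_xor_split (v i0) (Z (Fin.castAdd m i0)) (xor (parityOn n β Z) b)
  have el := ite_xor_split (v il) (Z (Fin.castAdd m il)) (xor (parityOn n α Z) a)
  omega

/-- CERTIFICATE of an identity word: the word is an identity word, its block trajectory is the stated linear function of
the initial state, the block overlap is even, and the sign-bit shift is the linear form `a·v_{n-1} + b·v_0`.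
Decidable; checked by `decide` for each concrete word below. -/
def wordCert (w α β : Fin m → Bool) (a b : Bool) : Bool :=
  decide ((∀ s : St, monodromy (List.ofFn w) s = s) ∧
    (∀ s : St, ∀ j, kernelVec w s j = ((α j && s.1) ^^ (β j && s.2))) ∧
    (∀ s : St, blockAnd w s % 2 = 0) ∧
    (∀ s : St, (blockEdges w s + blockAnd w s / 2) % 2 =
      ((if (a && s.1) = true then 1 else 0) + (if (b && s.2) = true then 1 else 0)) % 2))

/-- SteerDial helper `wordCert_spec` (lens-5 g7 SteerDial twin; see the enclosing section docstring). -/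
theorem wordCert_spec {w α β : Fin m → Bool} {a b : Bool} (h : wordCert w α β a b = true) :
    (∀ s : St, monodromy (List.ofFn w) s = s) ∧
    (∀ s : St, ∀ j, kernelVec w s j = ((α j && s.1) ^^ (β j && s.2))) ∧
    (∀ s : St, blockAnd w s % 2 = 0) ∧
    (∀ s : St, (blockEdges w s + blockAnd w s / 2) % 2 =
      ((if (a && s.1) = true then 1 else 0) + (if (b && s.2) = true then 1 else 0)) % 2) :=
  of_decide_eq_true h

/-- SteerDial helper `idWord_of_wordCert` (lens-5 g7 SteerDial twin; see the enclosing section docstring). -/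
theorem idWord_of_wordCert {w α β : Fin m → Bool} {a b : Bool} (h : wordCert w α β a b = true) : idWord w = true :=
  decide_eq_true (wordCert_spec h).1

/-- **THE IDENTITY-WORD FOLD LAW.** If the padded output `Z` is valid for `pad w y`, the folded output is valid for
`y`. -/
theorem rel_fold (hn : 3 ≤ n) (hm : 1 ≤ m) {w α β : Fin m → Bool} {a b : Bool} (cert : wordCert w α β a b = true)
    (y : Fin n → Bool) (Z : Fin (n + m) → Bool) (hZ : Rel (pad w y) Z) : Rel y (foldOut n α β a b Z) := by
  obtain ⟨-, hlin, heven, hflip⟩ := wordCert_spec cert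
  intro v hv
  have hs2 : (st0 hn v).2 = v ⟨0, by omega⟩ := rfl
  have hK := inKernel_liftVec hn (idWord_of_wordCert cert) hv
  have h := hZ _ hK
  rw [dot2_liftVec, signBit_liftVec hn hm w y v _ hs2] at h
  rw [dot2_foldOut hn]
  -- evenness of the two overlaps
  obtain ⟨W2, hW2⟩ := RingHLF.even_wtAnd_of_inKernel hv
  have hBA := heven (st0 hn v)
  have hfl := hflip (st0 hn v)
  have hbl := card_block_mod_two α β (kernelVec w (st0 hn v)) (fun j => Z (Fin.natAdd n j)) (st0 hn v)
    (hlin (st0 hn v))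
  -- name the quantities and finish by a finite check modulo 2
  unfold signBit
  simp only [st0] at hBA hfl hbl h
  obtain ⟨BA2, hBA2⟩ : ∃ t, blockAnd w (v ⟨n - 1, by omega⟩, v ⟨0, by omega⟩) = 2 * t :=
    ⟨blockAnd w (v ⟨n - 1, by omega⟩, v ⟨0, by omega⟩) / 2, by omega⟩
  rw [hW2, hBA2] at h
  rw [hW2]
  rw [show (W2 + W2 + 2 * BA2) / 2 = W2 + BA2 by omega] at h
  rw [show (W2 + W2) / 2 = W2 by omega]
  rw [hBA2, show 2 * BA2 / 2 = BA2 by omega] at hfl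
  have key : ∀ (p q a' b' : Bool) (D0 NA NB U BE BA' E W : ℕ),
      U % 2 = ((if p = true then NA else 0) + (if q = true then NB else 0)) % 2 →
      (BE + BA') % 2 = ((if (a' && p) = true then 1 else 0) + (if (b' && q) = true then 1 else 0)) % 2 →
      (D0 + U) % 2 = (E + BE + (W + BA')) % 2 →
      (D0 + (if p = true ∧ (xor (decide (NA % 2 = 1)) a') = true then 1 else 0) +
          (if q = true ∧ (xor (decide (NB % 2 = 1)) b') = true then 1 else 0)) % 2 = (E + W) % 2 := by
    intro p q a' b' D0 NA NB U BE BA' E W hU hf hh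
    have hNA := Nat.mod_two_eq_zero_or_one NA
    have hNB := Nat.mod_two_eq_zero_or_one NB
    cases p <;> cases q <;> cases a' <;> cases b' <;> rcases hNA with hA | hA <;> rcases hNB with hB | hB <;>
      (try simp [hA, hB] at hU hf hh ⊢) <;> omega
  exact key _ _ _ _ _ _ _ _ _ _ _ _ hbl hfl h

end Fold

end Summit.QuantumAdvantage.QuantumAdvantage.Theorems.SteerDial
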